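import Summits.QuantumFields.YangMills.Theorems.FluctuationComparisonRegPrIntLS2BetaTableDiagonal
import HarnessLib

/-!
# S2β · THE CUT-OFF-HEIGHT LAYER `K = J` OVER THE CANONICAL VERSION: H4ᶜ∘ `BeyondOneLoopSmallIntCan` (stub 4) and LFR♯ᶜ∘ `LargeFieldFourPtIntCan` (stub 5)
# ⟸ their `J < K` editions; 1L4ᶜ∘'s (R) ∧ (P) ∧ (T) on the diagonal

Cell `ym3-torus` (HUMAN RULING D-0037: rung R3 = continuum `SU(2)` Yang–Mills on `T³` — NOT `d = 4`, NOT infinite volume, NOT a mass gap, NOT the Clay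
problem); width seat `ym-ust-20520-w5` (gen 19); helper of the crux `stmt-QuantumFields-20520` `UnitScaleTilt.FluctuationComparisonRegPrIntL`
(`--supports … --as helper`, NOT a proof of it).  THEOREMS ONLY: 0 `def`, 0 `instance`, 0 `notation`, 0 `sorry`, default heartbeats.  FILE 2 of 2 (FILE 1 =
✓`…S2BetaTableDiagonal`: the Gibbs-version pinning, `minActionRegPr_{K,K} = A`, and the S2β door).

CONTEXT.  Registry `Cruxes/FluctuationComparisonRegPrIntL/Lines/semiclassical_s2beta.lean` v11.4 (3732b7df): the two sorried table stubs `stub_beyondOneLoopSmallIntCan :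
BeyondOneLoopSmallIntCan` (:571, H4ᶜ∘) and `stub_largeFieldFourPtIntCan : LargeFieldFourPtIntCan` (:588, LFR♯ᶜ∘), and the organ-fed row 1L4ᶜ∘ `OneLoopClusteredIntCan`
(:548), all read the run `K` at the height `J ≤ K` through the CANONICAL VERSION `heightDensityCan F γ′ hJK (histGood … K J)` of Bałaban's restricted density and the
λ-scaled fluctuation part `fluctAtCan λ V = log heightDensityCan F (γ∕λ) … V + β_K(γ∕λ)·minActionRegPr … V` (Lines-local `def`s :160 ∕ :321 ∕ :327 ∕ :333; here
δ-UNFOLDED, with `heightDensityCan` = its Theorems-side twin ✓`…WregGlue.heightDensityCan`, exactly as ✓`…S2BetaLaplaceKnit` §4 reads clause (T)).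

THIS FILE: on the diagonal `K = J` the history `histGood (θBal b₀) K K` is the ONE-level event `{PlaqSmall (θBal b₀ K)}` ⊇ the `c`-interior window, on which
`heightDensity F γ′ _ (histGood …) = e^{−β_K(γ′) A}` (✓`…HistoryPartition.heightDensity_self_eq`, px20 g12) is continuous, so (§1) the canonical version EQUALS
`e^{−β_K(γ′) A}` there for EVERY weight coupling `γ′` (`Node00.canonVersion_eqOn_of_continuousOn`), the window lies in the maximal regular set ((R)) and the version is
positive ((P)); (§2) with FILE 1's `minActionRegPr_{K,K} = A` the λ-scaled fluctuation part VANISHES identically on the interior window for every `λ`, so its 4-point is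
`0` for every `λ`, the semiclassical limit `limUnder atTop` is `0` ((T) with `Λ₄ = 0`), the H4ᶜ∘ integrand `Δ²f¹ − Λ₄` is `0`, and with FILE 1's Gibbs pinning the LFR♯ᶜ∘
integrand `log ρ − log heightDensityCan(γ)` is the constant `−log Z_K`; (§3) ★★★ the two doors `⟨stub text with (hJK : J < K)⟩ → ⟨registry stub text VERBATIM (δ-unfolded)⟩`
for H4ᶜ∘ and LFR♯ᶜ∘ (`γ₁ := min γ₁ γ₁^{diag}(L, c·b₀, p₀, ε₀)`; for LFR♯ᶜ∘, which has no `ε₀`, the diagonal needs no regularity threshold at all).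

NET (registry granularity, CREDITS NOTHING): a prover of stub 4 or stub 5 may assume `J < K`.  A CONSISTENCY rung at the cut-off height (px20 g12's sense), NOT a
piece of Bałaban's 𝐑-operation.  HONEST SCOPE: elementary; nothing of the stubs' `J < K` content, of EXW∘ ∕ GAP♯∘ ∕ DET-REP-B‴∘, of S2β, of the crux 20520, of EX ∕ 19936 ∕
19200 is proved or claimed; registry 20520 v11.4 0∕5 UNCHANGED; `YM3TorusSU2` NOT proved; the Yang–Mills mass gap (Clay) NOT proved.

References: [Balaban1985UV3] T. Bałaban, CMP 102 (1985): (1)–(2) p.256, (7) p.257, (41) p.266, (45)–(47) p.267; [Balaban1985Variational] CMP 102 (1985): (2), (6)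
p.278, Thm 1 (8) p.279; [Balaban1988Convergent] CMP 119 (1988) §2 (2.18)–(2.27) (the large-field expansion the stub names).
-/

set_option autoImplicit false

noncomputable section

open MeasureTheory Filter Topology Set
open scoped ENNReal
open Literature.MathematicalPhysics.QuantumFieldTheory.Balaban1983to89
open Literature.MathematicalPhysics.QuantumFieldTheory.Balaban1983to89.T3ContinuumYM3Torus
open Literature.MathematicalPhysics.QuantumFieldTheory.Balaban1983to89.T3NestedUnitLaws
open Literature.MathematicalPhysics.QuantumFieldTheory.Balaban1983to89.T3UnitLawDensityEML
open Literature.MathematicalPhysics.QuantumFieldTheory.Balaban1983to89.T3UnitScaleTilt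
open Literature.MathematicalPhysics.QuantumFieldTheory.Balaban1983to89.T3TiltDescent
open Literature.MathematicalPhysics.QuantumFieldTheory.Balaban1983to89.T3PrintedRegularMinimiser
open Literature.MathematicalPhysics.QuantumFieldTheory.Balaban1983to89.T3PrintedMinimiserExistence
open Literature.MathematicalPhysics.QuantumFieldTheory.Balaban1983to89.T3LevelShift
open Literature.MathematicalPhysics.QuantumFieldTheory.Balaban1983to89.Missing
open Literature.MathematicalPhysics.QuantumFieldTheory.Balaban1983to89.T4Continuum
open scoped Literature.MathematicalPhysics.QuantumFieldTheory.Balaban1983to89.T3OrbitAverage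
open Summit.QuantumFields.YangMills.Theorems.FluctuationComparisonRegPrIntLWregGlue (heightDensityCan continuous_boltzmann)
open Summit.QuantumFields.YangMills.Theorems.FluctuationComparisonRegPrIntLS2BetaTableDiagonal

namespace Summit.QuantumFields.YangMills.Theorems.FluctuationComparisonRegPrIntLS2BetaTableDiagonalCan

/-! ## §1 The canonical version on the diagonal: `heightDensityCan F γ′ _ (histGood … K K) = e^{−β_K(γ′) A}` on the interior window -/

section Canonical

variable (F : T3Family)

/-- On the diagonal the history is ONE level: `PlaqSmall (θ K) V → V ∈ histGood θ K K` (only `j = 0` binds; `Ū⁰ = V`). [cite: Balaban1985UV3, (7) p.257] -/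
theorem mem_histGood_self_of_plaqSmall {θ : ℕ → ℝ} {K : ℕ} {V : GaugeField (F.P K) 0 (Matrix.specialUnitaryGroup (Fin 2) ℂ)}
    (hV : PlaqSmall (θ K) V) : V ∈ histGood F ℰp θ K K := by
  intro j hj
  have hj0 : j = 0 := by omega
  subst hj0
  rw [Nat.sub_zero]
  exact hV

/-- The restricted Boltzmann weight `1_{histGood … K K}·e^{−βA}` is a.e. (indeed pointwise) equal to `e^{−βA}` on the interior window, as a version of the diagonal
height density. [cite: Balaban1985UV3, (2) p.256 and (41) p.266] -/
theorem boltzmann_ae_eq_heightDensity_self {γ b₀ c : ℝ} (γ' : ℝ) (hγ : 0 < γ) (hγ1 : γ ≤ 1) (hb : 0 < b₀) (hc1 : c ≤ 1) (p₀ : ℝ)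
    {K : ℕ} (hKK : K ≤ K) :
    (boltzmann (F.P K) ((F.scheme ℰp γ').β K) : GaugeField (F.P K) 0 (Matrix.specialUnitaryGroup (Fin 2) ℂ) → ℝ)
      =ᵐ[(fieldMeasure (F.P K) 0 (Matrix.specialUnitaryGroup (Fin 2) ℂ)).restrict
          {V : GaugeField (F.P K) 0 (Matrix.specialUnitaryGroup (Fin 2) ℂ) | PlaqSmall (θBal F.L γ (c * b₀) p₀ K) V}]
      heightDensity F γ' hKK (histGood F ℰp (θBal F.L γ b₀ p₀) K K) := by
  refine (ae_restrict_iff' (Node00.isOpen_plaqSmall _).measurableSet).mpr (Eventually.of_forall fun V hV => ?_)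
  have hVS : V ∈ histGood F ℰp (θBal F.L γ b₀ p₀) K K :=
    mem_histGood_self_of_plaqSmall F (plaqSmall_of_interior F hγ hγ1 hb hc1 p₀ K hV)
  have e : heightDensity F γ' hKK (histGood F ℰp (θBal F.L γ b₀ p₀) K K) V =
      heightDensity F γ' (le_refl K) (histGood F ℰp (θBal F.L γ b₀ p₀) K K) V := rfl
  rw [e, FluctuationComparisonRegPrIntLHistoryPartition.heightDensity_self_eq, Set.indicator_of_mem hVS]

/-- ★ **THE CANONICAL VERSION ON THE DIAGONAL IS THE BOLTZMANN WEIGHT**, pointwise on the interior window, for EVERY weight coupling `γ′`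
(`0 < γ ≤ 1`, `0 < b₀`, `c ≤ 1`). [cite: Balaban1985UV3, (2) p.256 and (41) p.266] -/
theorem heightDensityCan_self_eqOn {γ b₀ c : ℝ} (γ' : ℝ) (hγ : 0 < γ) (hγ1 : γ ≤ 1) (hb : 0 < b₀) (hc1 : c ≤ 1) (p₀ : ℝ)
    {K : ℕ} (hKK : K ≤ K) :
    EqOn (heightDensityCan F γ' hKK (histGood F ℰp (θBal F.L γ b₀ p₀) K K))
      (boltzmann (F.P K) ((F.scheme ℰp γ').β K))
      {V : GaugeField (F.P K) 0 (Matrix.specialUnitaryGroup (Fin 2) ℂ) | PlaqSmall (θBal F.L γ (c * b₀) p₀ K) V} := by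
  haveI := B12ContinuousTransportInvariance.isOpenPosMeasure_fieldMeasure_SU (N := 2) (F.P K) 0
  exact Node00.canonVersion_eqOn_of_continuousOn (Node00.isOpen_plaqSmall _) (continuous_boltzmann _ _).continuousOn
    (boltzmann_ae_eq_heightDensity_self F γ' hγ hγ1 hb hc1 p₀ hKK)

/-- **(R) ON THE DIAGONAL**: the interior window lies in the maximal regular set of the diagonal height density, for every weight coupling. [cite: Balaban1985UV3, (2) p.256] -/
theorem interiorWindow_subset_regSet_self {γ b₀ c : ℝ} (γ' : ℝ) (hγ : 0 < γ) (hγ1 : γ ≤ 1) (hb : 0 < b₀) (hc1 : c ≤ 1) (p₀ : ℝ)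
    {K : ℕ} (hKK : K ≤ K) :
    {V : GaugeField (F.P K) 0 (Matrix.specialUnitaryGroup (Fin 2) ℂ) | PlaqSmall (θBal F.L γ (c * b₀) p₀ K) V} ⊆
      Node00.regSet (fieldMeasure (F.P K) 0 (Matrix.specialUnitaryGroup (Fin 2) ℂ))
        (heightDensity F γ' hKK (histGood F ℰp (θBal F.L γ b₀ p₀) K K)) :=
  Node00.subset_regSet (Node00.isOpen_plaqSmall _)
    ⟨_, (continuous_boltzmann _ _).continuousOn, boltzmann_ae_eq_heightDensity_self F γ' hγ hγ1 hb hc1 p₀ hKK⟩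

/-- **(P) ON THE DIAGONAL**: the canonical version is positive on the interior window, for every weight coupling. [cite: Balaban1985UV3, (2) p.256] -/
theorem heightDensityCan_self_pos {γ b₀ c : ℝ} (γ' : ℝ) (hγ : 0 < γ) (hγ1 : γ ≤ 1) (hb : 0 < b₀) (hc1 : c ≤ 1) (p₀ : ℝ)
    {K : ℕ} (hKK : K ≤ K) {V : GaugeField (F.P K) 0 (Matrix.specialUnitaryGroup (Fin 2) ℂ)} (hV : PlaqSmall (θBal F.L γ (c * b₀) p₀ K) V) :
    0 < heightDensityCan F γ' hKK (histGood F ℰp (θBal F.L γ b₀ p₀) K K) V := by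
  rw [heightDensityCan_self_eqOn F γ' hγ hγ1 hb hc1 p₀ hKK hV]
  exact boltzmann_pos _ _ _

end Canonical

/-! ## §2 On the diagonal the λ-scaled fluctuation part vanishes identically; `Λ₄ = 0`; the LFR♯ᶜ∘ integrand is constant -/

section Vanishing

variable (F : T3Family)

/-- ★ **`fluctAtCan λ ≡ 0` ON THE DIAGONAL INTERIOR WINDOW** (every `λ`; window radius `θ = θBal(c b₀)(K)` with `θ ≤ ε₀`, `4θ < ε₀`):
`log e^{−β_K(γ∕λ)A(V)} + β_K(γ∕λ)·A(V) = 0`. [cite: Balaban1985UV3, (2) p.256 and (41) p.266; Balaban1985Variational, Thm 1 (8) p.279] -/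
theorem fluctAtCan_self_eq_zero {γ b₀ c : ℝ} (hγ : 0 < γ) (hγ1 : γ ≤ 1) (hb : 0 < b₀) (hc1 : c ≤ 1) (p₀ : ℝ) {K : ℕ} (hKK : K ≤ K)
    {ε₀ : ℝ} (hθε : θBal F.L γ (c * b₀) p₀ K ≤ ε₀) (h4 : 4 * θBal F.L γ (c * b₀) p₀ K < ε₀) (lam : ℝ)
    {V : GaugeField (F.P K) 0 (Matrix.specialUnitaryGroup (Fin 2) ℂ)} (hV : PlaqSmall (θBal F.L γ (c * b₀) p₀ K) V) :
    Real.log (heightDensityCan F (γ / lam) hKK (histGood F ℰp (θBal F.L γ b₀ p₀) K K) V)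
      + (F.scheme ℰp (γ / lam)).β K * minActionRegPr F K K hKK ε₀ V = 0 := by
  rw [heightDensityCan_self_eqOn F (γ / lam) hγ hγ1 hb hc1 p₀ hKK hV, minActionRegPr_self_eq F hKK hθε h4 hV, boltzmann, Real.log_exp]
  ring

/-- ★ **THE LFR♯ᶜ∘ INTEGRAND ON THE DIAGONAL IS THE CONSTANT `−log Z_K`**: with `Gibbs_K = dV.withDensity ρ`, `ρ` continuous on the interior window,
`log ρ − log heightDensityCan(γ) = −log Z_K` there. [cite: Balaban1985UV3, (2) p.256 and (41) p.266] -/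
theorem log_sub_log_heightDensityCan_self_eq {γ b₀ c : ℝ} (hγ : 0 < γ) (hγ1 : γ ≤ 1) (hb : 0 < b₀) (hc1 : c ≤ 1) (p₀ : ℝ) {K : ℕ} (hKK : K ≤ K)
    {ρ : GaugeField (F.P K) 0 (Matrix.specialUnitaryGroup (Fin 2) ℂ) → ℝ}
    (hν : T4GenFunBounds.gibbsMeasure (G := Matrix.specialUnitaryGroup (Fin 2) ℂ) (F.P K) ((F.scheme ℰp γ).β K) =
      (fieldMeasure (F.P K) 0 (Matrix.specialUnitaryGroup (Fin 2) ℂ)).withDensity fun U => ENNReal.ofReal (ρ U))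
    (hρ : ContinuousOn ρ {U | PlaqSmall (θBal F.L γ (c * b₀) p₀ K) U})
    {V : GaugeField (F.P K) 0 (Matrix.specialUnitaryGroup (Fin 2) ℂ)} (hV : PlaqSmall (θBal F.L γ (c * b₀) p₀ K) V) :
    Real.log (ρ V) - Real.log (heightDensityCan F γ hKK (histGood F ℰp (θBal F.L γ b₀ p₀) K K) V) =
      -Real.log (partitionFn (G := Matrix.specialUnitaryGroup (Fin 2) ℂ) (F.P K) ((F.scheme ℰp γ).β K)) := by
  rw [log_version_eq_of_withDensity_eq (F.P K) (F.scheme_β_nonneg ℰp hγ.le K) (Node00.isOpen_plaqSmall _) hρ hν hV,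
    heightDensityCan_self_eqOn F γ hγ hγ1 hb hc1 p₀ hKK hV, boltzmann, Real.log_exp]
  ring

/-- ★ **(T) ON THE DIAGONAL WITH `Λ₄ = 0`**: at every interior-window quadrilateral the λ-scaled 4-point `λ ↦ Δ² fluctAtCan λ` (δ-unfolded) is the ZERO
function, so its `limUnder atTop` (the Lines-local `oneLoopFourPtCan`) is `0` and the `Tendsto` clause of 1L4ᶜ∘ (T) holds on the diagonal (1L4ᶜ∘ itself is PROVED in
the registry from its organs; no door is needed for it — this is its cut-off layer for the record). [cite: Balaban1985Variational, Thm 1 (8) p.279; Balaban1985UV3, (41) p.266] -/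
theorem fourPt_fluctAtCan_self {γ b₀ c : ℝ} (hγ : 0 < γ) (hγ1 : γ ≤ 1) (hb : 0 < b₀) (hc1 : c ≤ 1) (p₀ : ℝ) {K : ℕ} (hKK : K ≤ K)
    {ε₀ : ℝ} (hθε : θBal F.L γ (c * b₀) p₀ K ≤ ε₀) (h4 : 4 * θBal F.L γ (c * b₀) p₀ K < ε₀)
    {U V W Z : GaugeField (F.P K) 0 (Matrix.specialUnitaryGroup (Fin 2) ℂ)}
    (hU : PlaqSmall (θBal F.L γ (c * b₀) p₀ K) U) (hV : PlaqSmall (θBal F.L γ (c * b₀) p₀ K) V)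
    (hW : PlaqSmall (θBal F.L γ (c * b₀) p₀ K) W) (hZ : PlaqSmall (θBal F.L γ (c * b₀) p₀ K) Z) :
    (fun lam : ℝ =>
        ((Real.log (heightDensityCan F (γ / lam) hKK (histGood F ℰp (θBal F.L γ b₀ p₀) K K) U)
            + (F.scheme ℰp (γ / lam)).β K * minActionRegPr F K K hKK ε₀ U)
          - (Real.log (heightDensityCan F (γ / lam) hKK (histGood F ℰp (θBal F.L γ b₀ p₀) K K) V)
            + (F.scheme ℰp (γ / lam)).β K * minActionRegPr F K K hKK ε₀ V))
        - ((Real.log (heightDensityCan F (γ / lam) hKK (histGood F ℰp (θBal F.L γ b₀ p₀) K K) W)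
            + (F.scheme ℰp (γ / lam)).β K * minActionRegPr F K K hKK ε₀ W)
          - (Real.log (heightDensityCan F (γ / lam) hKK (histGood F ℰp (θBal F.L γ b₀ p₀) K K) Z)
            + (F.scheme ℰp (γ / lam)).β K * minActionRegPr F K K hKK ε₀ Z))) = (fun _ => 0) ∧
    limUnder atTop (fun lam : ℝ =>
        ((Real.log (heightDensityCan F (γ / lam) hKK (histGood F ℰp (θBal F.L γ b₀ p₀) K K) U)
            + (F.scheme ℰp (γ / lam)).β K * minActionRegPr F K K hKK ε₀ U)
          - (Real.log (heightDensityCan F (γ / lam) hKK (histGood F ℰp (θBal F.L γ b₀ p₀) K K) V)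
            + (F.scheme ℰp (γ / lam)).β K * minActionRegPr F K K hKK ε₀ V))
        - ((Real.log (heightDensityCan F (γ / lam) hKK (histGood F ℰp (θBal F.L γ b₀ p₀) K K) W)
            + (F.scheme ℰp (γ / lam)).β K * minActionRegPr F K K hKK ε₀ W)
          - (Real.log (heightDensityCan F (γ / lam) hKK (histGood F ℰp (θBal F.L γ b₀ p₀) K K) Z)
            + (F.scheme ℰp (γ / lam)).β K * minActionRegPr F K K hKK ε₀ Z))) = 0 := by
  have h0 : ∀ (lam : ℝ) {X : GaugeField (F.P K) 0 (Matrix.specialUnitaryGroup (Fin 2) ℂ)}, PlaqSmall (θBal F.L γ (c * b₀) p₀ K) X →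
      Real.log (heightDensityCan F (γ / lam) hKK (histGood F ℰp (θBal F.L γ b₀ p₀) K K) X)
        + (F.scheme ℰp (γ / lam)).β K * minActionRegPr F K K hKK ε₀ X = 0 :=
    fun lam X hX => fluctAtCan_self_eq_zero F hγ hγ1 hb hc1 p₀ hKK hθε h4 lam hX
  have hfun : (fun lam : ℝ =>
        ((Real.log (heightDensityCan F (γ / lam) hKK (histGood F ℰp (θBal F.L γ b₀ p₀) K K) U)
            + (F.scheme ℰp (γ / lam)).β K * minActionRegPr F K K hKK ε₀ U)
          - (Real.log (heightDensityCan F (γ / lam) hKK (histGood F ℰp (θBal F.L γ b₀ p₀) K K) V)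
            + (F.scheme ℰp (γ / lam)).β K * minActionRegPr F K K hKK ε₀ V))
        - ((Real.log (heightDensityCan F (γ / lam) hKK (histGood F ℰp (θBal F.L γ b₀ p₀) K K) W)
            + (F.scheme ℰp (γ / lam)).β K * minActionRegPr F K K hKK ε₀ W)
          - (Real.log (heightDensityCan F (γ / lam) hKK (histGood F ℰp (θBal F.L γ b₀ p₀) K K) Z)
            + (F.scheme ℰp (γ / lam)).β K * minActionRegPr F K K hKK ε₀ Z))) = fun _ => 0 := by
    funext lam
    rw [h0 lam hU, h0 lam hV, h0 lam hW, h0 lam hZ]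
    ring
  refine ⟨hfun, ?_⟩
  rw [hfun]
  exact (tendsto_const_nhds (x := (0 : ℝ)) (f := (atTop : Filter ℝ))).limUnder_eq

/-- **THE COUPLING THRESHOLD AT THE INTERIOR PROFILE** `c·b₀` (FILE 1's `exists_gamma_diagonal`), restated for convenience. [cite: Balaban1985UV3, (7) p.257] -/
theorem exists_gamma_diagonal_interior {L : ℕ} (hL : 1 ≤ L) (c b₀ p₀ : ℝ) {ε₀ : ℝ} (hε₀ : 0 < ε₀) :
    ∃ γ₁ : ℝ, 0 < γ₁ ∧ γ₁ ≤ 1 ∧ ∀ γ : ℝ, 0 < γ → γ ≤ γ₁ → ∀ i : ℕ,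
      θBal L γ (c * b₀) p₀ i ≤ ε₀ ∧ 4 * θBal L γ (c * b₀) p₀ i < ε₀ :=
  exists_gamma_diagonal hL (c * b₀) p₀ hε₀

end Vanishing

/-! ## §3 THE DOORS: stubs 4 and 5 from their off-diagonal (`J < K`) editions -/

section Doors

/-- ★★★ **H4ᶜ∘ `BeyondOneLoopSmallIntCan` (registry v11.4 :571 = the type of `stub_beyondOneLoopSmallIntCan`, Lines-local `fourPt`∕`fluctAtCan`∕`oneLoopFourPtCan` δ-UNFOLDED)
FROM ITS OFF-DIAGONAL EDITION** (`(hJK : J ≤ K)` ↦ `(hJK : J < K)`, `hJK.le` inside): `c₀, pS, ε₁, κ, φ₂` unchanged, `γ₁ := min γ₁ γ₁^{diag}(L, c·b₀, p₀, ε₀)`; on the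
diagonal every `fluctAtCan λ` term vanishes (§2), so `Δ²f¹ = 0`, `Λ₄ = limUnder atTop 0 = 0`, `|0 − 0| ≤ φ₂ J·e^{−κd}`. [cite: Balaban1985UV3, (45)-(47) p.267] -/
theorem beyondOneLoopSmallIntCan_of_offDiagonal
    (h :
      ∀ (L : ℕ), ∃ c₀ : ℝ, 0 < c₀ ∧ c₀ ≤ 1 ∧ ∀ (c : ℝ), 0 < c → c ≤ c₀ → ∃ pS : ℝ, ∀ (b₀ p₀ : ℝ), 0 < b₀ → pS ≤ p₀ → 0 < p₀ →
        ∃ ε₁ : ℝ, 0 < ε₁ ∧ ∀ (ε₀ : ℝ), 0 < ε₀ → ε₀ ≤ ε₁ →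
        ∃ γ₁ : ℝ, 0 < γ₁ ∧ ∃ κ : ℝ, 0 < κ ∧ ∀ (F : T3Family) (γ : ℝ), F.L = L → 0 < γ → γ ≤ γ₁ →
          ∃ φ₂ : ℕ → ℝ, (∀ J, 0 ≤ φ₂ J) ∧ Tendsto (fun J : ℕ => (J : ℝ) * φ₂ J) atTop (𝓝 0) ∧
            ∀ (J K : ℕ) (hJK : J < K) (b b' : PBond (F.P J) 0) (U V W Z : GaugeField (F.P J) 0 (Matrix.specialUnitaryGroup (Fin 2) ℂ)),
              PlaqSmall (θBal F.L γ (c * b₀) p₀ J) U → PlaqSmall (θBal F.L γ (c * b₀) p₀ J) V →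
              PlaqSmall (θBal F.L γ (c * b₀) p₀ J) W → PlaqSmall (θBal F.L γ (c * b₀) p₀ J) Z →
              (∀ e, e ≠ b → U e = V e) → (∀ e, e ≠ b' → U e = W e) → (∀ e, e ≠ b' → V e = Z e) → (∀ e, e ≠ b → W e = Z e) →
              |(((Real.log (heightDensityCan F (γ / 1) hJK.le (histGood F ℰp (θBal F.L γ b₀ p₀) K J) U)
                  + (F.scheme ℰp (γ / 1)).β K * minActionRegPr F J K hJK.le ε₀ U)
                - (Real.log (heightDensityCan F (γ / 1) hJK.le (histGood F ℰp (θBal F.L γ b₀ p₀) K J) V)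
                  + (F.scheme ℰp (γ / 1)).β K * minActionRegPr F J K hJK.le ε₀ V))
              - ((Real.log (heightDensityCan F (γ / 1) hJK.le (histGood F ℰp (θBal F.L γ b₀ p₀) K J) W)
                  + (F.scheme ℰp (γ / 1)).β K * minActionRegPr F J K hJK.le ε₀ W)
                - (Real.log (heightDensityCan F (γ / 1) hJK.le (histGood F ℰp (θBal F.L γ b₀ p₀) K J) Z)
                  + (F.scheme ℰp (γ / 1)).β K * minActionRegPr F J K hJK.le ε₀ Z)))
              - limUnder atTop (fun lam : ℝ =>
              (((Real.log (heightDensityCan F (γ / lam) hJK.le (histGood F ℰp (θBal F.L γ b₀ p₀) K J) U)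
                  + (F.scheme ℰp (γ / lam)).β K * minActionRegPr F J K hJK.le ε₀ U)
                - (Real.log (heightDensityCan F (γ / lam) hJK.le (histGood F ℰp (θBal F.L γ b₀ p₀) K J) V)
                  + (F.scheme ℰp (γ / lam)).β K * minActionRegPr F J K hJK.le ε₀ V))
              - ((Real.log (heightDensityCan F (γ / lam) hJK.le (histGood F ℰp (θBal F.L γ b₀ p₀) K J) W)
                  + (F.scheme ℰp (γ / lam)).β K * minActionRegPr F J K hJK.le ε₀ W)
                - (Real.log (heightDensityCan F (γ / lam) hJK.le (histGood F ℰp (θBal F.L γ b₀ p₀) K J) Z)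
                  + (F.scheme ℰp (γ / lam)).β K * minActionRegPr F J K hJK.le ε₀ Z))))|
                ≤ φ₂ J * Real.exp (-(κ * (b.src.tdist b'.src : ℝ)))) :
    ∀ (L : ℕ), ∃ c₀ : ℝ, 0 < c₀ ∧ c₀ ≤ 1 ∧ ∀ (c : ℝ), 0 < c → c ≤ c₀ → ∃ pS : ℝ, ∀ (b₀ p₀ : ℝ), 0 < b₀ → pS ≤ p₀ → 0 < p₀ →
        ∃ ε₁ : ℝ, 0 < ε₁ ∧ ∀ (ε₀ : ℝ), 0 < ε₀ → ε₀ ≤ ε₁ →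
        ∃ γ₁ : ℝ, 0 < γ₁ ∧ ∃ κ : ℝ, 0 < κ ∧ ∀ (F : T3Family) (γ : ℝ), F.L = L → 0 < γ → γ ≤ γ₁ →
          ∃ φ₂ : ℕ → ℝ, (∀ J, 0 ≤ φ₂ J) ∧ Tendsto (fun J : ℕ => (J : ℝ) * φ₂ J) atTop (𝓝 0) ∧
            ∀ (J K : ℕ) (hJK : J ≤ K) (b b' : PBond (F.P J) 0) (U V W Z : GaugeField (F.P J) 0 (Matrix.specialUnitaryGroup (Fin 2) ℂ)),
              PlaqSmall (θBal F.L γ (c * b₀) p₀ J) U → PlaqSmall (θBal F.L γ (c * b₀) p₀ J) V →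
              PlaqSmall (θBal F.L γ (c * b₀) p₀ J) W → PlaqSmall (θBal F.L γ (c * b₀) p₀ J) Z →
              (∀ e, e ≠ b → U e = V e) → (∀ e, e ≠ b' → U e = W e) → (∀ e, e ≠ b' → V e = Z e) → (∀ e, e ≠ b → W e = Z e) →
              |(((Real.log (heightDensityCan F (γ / 1) hJK (histGood F ℰp (θBal F.L γ b₀ p₀) K J) U)
                  + (F.scheme ℰp (γ / 1)).β K * minActionRegPr F J K hJK ε₀ U)
                - (Real.log (heightDensityCan F (γ / 1) hJK (histGood F ℰp (θBal F.L γ b₀ p₀) K J) V)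
                  + (F.scheme ℰp (γ / 1)).β K * minActionRegPr F J K hJK ε₀ V))
              - ((Real.log (heightDensityCan F (γ / 1) hJK (histGood F ℰp (θBal F.L γ b₀ p₀) K J) W)
                  + (F.scheme ℰp (γ / 1)).β K * minActionRegPr F J K hJK ε₀ W)
                - (Real.log (heightDensityCan F (γ / 1) hJK (histGood F ℰp (θBal F.L γ b₀ p₀) K J) Z)
                  + (F.scheme ℰp (γ / 1)).β K * minActionRegPr F J K hJK ε₀ Z)))
              - limUnder atTop (fun lam : ℝ =>
              (((Real.log (heightDensityCan F (γ / lam) hJK (histGood F ℰp (θBal F.L γ b₀ p₀) K J) U)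
                  + (F.scheme ℰp (γ / lam)).β K * minActionRegPr F J K hJK ε₀ U)
                - (Real.log (heightDensityCan F (γ / lam) hJK (histGood F ℰp (θBal F.L γ b₀ p₀) K J) V)
                  + (F.scheme ℰp (γ / lam)).β K * minActionRegPr F J K hJK ε₀ V))
              - ((Real.log (heightDensityCan F (γ / lam) hJK (histGood F ℰp (θBal F.L γ b₀ p₀) K J) W)
                  + (F.scheme ℰp (γ / lam)).β K * minActionRegPr F J K hJK ε₀ W)
                - (Real.log (heightDensityCan F (γ / lam) hJK (histGood F ℰp (θBal F.L γ b₀ p₀) K J) Z)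
                  + (F.scheme ℰp (γ / lam)).β K * minActionRegPr F J K hJK ε₀ Z))))|
                ≤ φ₂ J * Real.exp (-(κ * (b.src.tdist b'.src : ℝ))) := by
  intro L
  obtain ⟨c₀, hc₀, hc₀1, H⟩ := h L
  refine ⟨c₀, hc₀, hc₀1, fun c hc hcle => ?_⟩
  obtain ⟨pS, H⟩ := H c hc hcle
  refine ⟨pS, fun b₀ p₀ hb hpS hp => ?_⟩
  obtain ⟨ε₁, hε₁, H⟩ := H b₀ p₀ hb hpS hp
  refine ⟨ε₁, hε₁, fun ε₀ hε₀ hε₀1 => ?_⟩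
  obtain ⟨γ₁, hγ₁, κ, hκ, H⟩ := H ε₀ hε₀ hε₀1
  by_cases hL : 1 ≤ L
  swap
  · refine ⟨1, one_pos, κ, hκ, fun F γ hFL => ?_⟩
    exact absurd (hFL ▸ F.hL.2.le : 1 ≤ L) hL
  obtain ⟨γd, hγd, hγd1, Hd⟩ := exists_gamma_diagonal_interior hL c b₀ p₀ hε₀
  refine ⟨min γ₁ γd, lt_min hγ₁ hγd, κ, hκ, fun F γ hFL hγ hγle => ?_⟩
  obtain ⟨φ₂, hφ0, hφt, H⟩ := H F γ hFL hγ (hγle.trans (min_le_left _ _))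
  refine ⟨φ₂, hφ0, hφt, fun J K hJK b b' U V W Z hU hV hW hZ hUV hUW hVZ hWZ => ?_⟩
  rcases eq_or_lt_of_le hJK with hJKeq | hJKlt
  · subst hJKeq
    have hγ1 : γ ≤ 1 := (hγle.trans (min_le_right _ _)).trans hγd1
    have hc1 : c ≤ 1 := hcle.trans hc₀1
    obtain ⟨hθε, h4⟩ := Hd γ hγ (hγle.trans (min_le_right _ _)) J
    rw [← hFL] at hθε h4
    have h0 : ∀ (lam : ℝ) {X : GaugeField (F.P J) 0 (Matrix.specialUnitaryGroup (Fin 2) ℂ)}, PlaqSmall (θBal F.L γ (c * b₀) p₀ J) X →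
        Real.log (heightDensityCan F (γ / lam) hJK (histGood F ℰp (θBal F.L γ b₀ p₀) J J) X)
          + (F.scheme ℰp (γ / lam)).β J * minActionRegPr F J J hJK ε₀ X = 0 :=
      fun lam X hX => fluctAtCan_self_eq_zero F hγ hγ1 hb hc1 p₀ hJK hθε h4 lam hX
    have hfun : (fun lam : ℝ =>
        ((Real.log (heightDensityCan F (γ / lam) hJK (histGood F ℰp (θBal F.L γ b₀ p₀) J J) U)
            + (F.scheme ℰp (γ / lam)).β J * minActionRegPr F J J hJK ε₀ U)
          - (Real.log (heightDensityCan F (γ / lam) hJK (histGood F ℰp (θBal F.L γ b₀ p₀) J J) V)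
            + (F.scheme ℰp (γ / lam)).β J * minActionRegPr F J J hJK ε₀ V))
        - ((Real.log (heightDensityCan F (γ / lam) hJK (histGood F ℰp (θBal F.L γ b₀ p₀) J J) W)
            + (F.scheme ℰp (γ / lam)).β J * minActionRegPr F J J hJK ε₀ W)
          - (Real.log (heightDensityCan F (γ / lam) hJK (histGood F ℰp (θBal F.L γ b₀ p₀) J J) Z)
            + (F.scheme ℰp (γ / lam)).β J * minActionRegPr F J J hJK ε₀ Z))) = fun _ => 0 := by
      funext lam
      rw [h0 lam hU, h0 lam hV, h0 lam hW, h0 lam hZ]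
      ring
    rw [hfun, (tendsto_const_nhds (x := (0 : ℝ)) (f := (atTop : Filter ℝ))).limUnder_eq, h0 1 hU, h0 1 hV, h0 1 hW, h0 1 hZ]
    norm_num
    exact mul_nonneg (hφ0 J) (Real.exp_pos _).le
  · exact H J K hJKlt b b' U V W Z hU hV hW hZ hUV hUW hVZ hWZ

/-- ★★★ **LFR♯ᶜ∘ `LargeFieldFourPtIntCan` (registry v11.4 :588 = the type of `stub_largeFieldFourPtIntCan`, Lines-local `fourPt` δ-UNFOLDED) FROM ITS OFF-DIAGONAL
EDITION** (`(hJK : J ≤ K)` ↦ `(hJK : J < K)`, `hJK.le` inside): `c₀, pS, κ, ψ` unchanged, `γ₁ := min γ₁ 1` (the row has no `ε₀`: the diagonal needs only `γ ≤ 1` for the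
window inclusion); on the diagonal `log ρ − log heightDensityCan(γ) = −log Z_K` is constant on the interior window (§2), so the 4-point is `0`.
[cite: Balaban1988Convergent, §2 (2.18)-(2.27); Balaban1985UV3, (41) p.266] -/
theorem largeFieldFourPtIntCan_of_offDiagonal
    (h :
      ∀ (L : ℕ), ∃ c₀ : ℝ, 0 < c₀ ∧ c₀ ≤ 1 ∧ ∀ (c : ℝ), 0 < c → c ≤ c₀ → ∃ pS : ℝ, ∀ (b₀ p₀ : ℝ), 0 < b₀ → pS ≤ p₀ → 0 < p₀ →
        ∃ γ₁ : ℝ, 0 < γ₁ ∧ ∃ κ : ℝ, 0 < κ ∧ ∀ (F : T3Family) (γ : ℝ), F.L = L → 0 < γ → γ ≤ γ₁ →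
          ∃ ψ : ℕ → ℝ, (∀ J, 0 ≤ ψ J) ∧ Tendsto (fun J : ℕ => (J : ℝ) * ψ J) atTop (𝓝 0) ∧
            ∀ (ν : ℕ → (j : ℕ) → Measure (GaugeField (F.P j) 0 (Matrix.specialUnitaryGroup (Fin 2) ℂ))),
              (∀ K, ν K K = T4GenFunBounds.gibbsMeasure (F.P K) ((F.scheme ℰp γ).β K)) →
              (∀ K j, j < K → ν K j = Measure.map (descend F ℰp j) (ν K (j + 1))) →
              ∀ (J K : ℕ) (hJK : J < K) (ρ : GaugeField (F.P J) 0 (Matrix.specialUnitaryGroup (Fin 2) ℂ) → ℝ),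
                (∀ U, PlaqSmall (θBal F.L γ (c * b₀) p₀ J) U → 0 < ρ U) →
                ν K J = (fieldMeasure _ _ _).withDensity (fun U => ENNReal.ofReal (ρ U)) →
                ContinuousOn ρ {U | PlaqSmall (θBal F.L γ (c * b₀) p₀ J) U} →
                (∀ U : GaugeField (F.P J) 0 (Matrix.specialUnitaryGroup (Fin 2) ℂ), PlaqSmall (θBal F.L γ (c * b₀) p₀ J) U →
                    0 < heightDensityCan F γ hJK.le (histGood F ℰp (θBal F.L γ b₀ p₀) K J) U) →
                ∀ (b b' : PBond (F.P J) 0) (U V W Z : GaugeField (F.P J) 0 (Matrix.specialUnitaryGroup (Fin 2) ℂ)),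
                  PlaqSmall (θBal F.L γ (c * b₀) p₀ J) U → PlaqSmall (θBal F.L γ (c * b₀) p₀ J) V →
                  PlaqSmall (θBal F.L γ (c * b₀) p₀ J) W → PlaqSmall (θBal F.L γ (c * b₀) p₀ J) Z →
                  (∀ e, e ≠ b → U e = V e) → (∀ e, e ≠ b' → U e = W e) → (∀ e, e ≠ b' → V e = Z e) → (∀ e, e ≠ b → W e = Z e) →
                |((Real.log (ρ U) - Real.log (heightDensityCan F γ hJK.le (histGood F ℰp (θBal F.L γ b₀ p₀) K J) U))
                    - (Real.log (ρ V) - Real.log (heightDensityCan F γ hJK.le (histGood F ℰp (θBal F.L γ b₀ p₀) K J) V)))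
                  - ((Real.log (ρ W) - Real.log (heightDensityCan F γ hJK.le (histGood F ℰp (θBal F.L γ b₀ p₀) K J) W))
                    - (Real.log (ρ Z) - Real.log (heightDensityCan F γ hJK.le (histGood F ℰp (θBal F.L γ b₀ p₀) K J) Z)))|
                  ≤ ψ J * Real.exp (-(κ * (b.src.tdist b'.src : ℝ)))) :
    ∀ (L : ℕ), ∃ c₀ : ℝ, 0 < c₀ ∧ c₀ ≤ 1 ∧ ∀ (c : ℝ), 0 < c → c ≤ c₀ → ∃ pS : ℝ, ∀ (b₀ p₀ : ℝ), 0 < b₀ → pS ≤ p₀ → 0 < p₀ →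
        ∃ γ₁ : ℝ, 0 < γ₁ ∧ ∃ κ : ℝ, 0 < κ ∧ ∀ (F : T3Family) (γ : ℝ), F.L = L → 0 < γ → γ ≤ γ₁ →
          ∃ ψ : ℕ → ℝ, (∀ J, 0 ≤ ψ J) ∧ Tendsto (fun J : ℕ => (J : ℝ) * ψ J) atTop (𝓝 0) ∧
            ∀ (ν : ℕ → (j : ℕ) → Measure (GaugeField (F.P j) 0 (Matrix.specialUnitaryGroup (Fin 2) ℂ))),
              (∀ K, ν K K = T4GenFunBounds.gibbsMeasure (F.P K) ((F.scheme ℰp γ).β K)) →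
              (∀ K j, j < K → ν K j = Measure.map (descend F ℰp j) (ν K (j + 1))) →
              ∀ (J K : ℕ) (hJK : J ≤ K) (ρ : GaugeField (F.P J) 0 (Matrix.specialUnitaryGroup (Fin 2) ℂ) → ℝ),
                (∀ U, PlaqSmall (θBal F.L γ (c * b₀) p₀ J) U → 0 < ρ U) →
                ν K J = (fieldMeasure _ _ _).withDensity (fun U => ENNReal.ofReal (ρ U)) →
                ContinuousOn ρ {U | PlaqSmall (θBal F.L γ (c * b₀) p₀ J) U} →
                (∀ U : GaugeField (F.P J) 0 (Matrix.specialUnitaryGroup (Fin 2) ℂ), PlaqSmall (θBal F.L γ (c * b₀) p₀ J) U →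
                    0 < heightDensityCan F γ hJK (histGood F ℰp (θBal F.L γ b₀ p₀) K J) U) →
                ∀ (b b' : PBond (F.P J) 0) (U V W Z : GaugeField (F.P J) 0 (Matrix.specialUnitaryGroup (Fin 2) ℂ)),
                  PlaqSmall (θBal F.L γ (c * b₀) p₀ J) U → PlaqSmall (θBal F.L γ (c * b₀) p₀ J) V →
                  PlaqSmall (θBal F.L γ (c * b₀) p₀ J) W → PlaqSmall (θBal F.L γ (c * b₀) p₀ J) Z →
                  (∀ e, e ≠ b → U e = V e) → (∀ e, e ≠ b' → U e = W e) → (∀ e, e ≠ b' → V e = Z e) → (∀ e, e ≠ b → W e = Z e) →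
                |((Real.log (ρ U) - Real.log (heightDensityCan F γ hJK (histGood F ℰp (θBal F.L γ b₀ p₀) K J) U))
                    - (Real.log (ρ V) - Real.log (heightDensityCan F γ hJK (histGood F ℰp (θBal F.L γ b₀ p₀) K J) V)))
                  - ((Real.log (ρ W) - Real.log (heightDensityCan F γ hJK (histGood F ℰp (θBal F.L γ b₀ p₀) K J) W))
                    - (Real.log (ρ Z) - Real.log (heightDensityCan F γ hJK (histGood F ℰp (θBal F.L γ b₀ p₀) K J) Z)))|
                  ≤ ψ J * Real.exp (-(κ * (b.src.tdist b'.src : ℝ))) := by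
  intro L
  obtain ⟨c₀, hc₀, hc₀1, H⟩ := h L
  refine ⟨c₀, hc₀, hc₀1, fun c hc hcle => ?_⟩
  obtain ⟨pS, H⟩ := H c hc hcle
  refine ⟨pS, fun b₀ p₀ hb hpS hp => ?_⟩
  obtain ⟨γ₁, hγ₁, κ, hκ, H⟩ := H b₀ p₀ hb hpS hp
  refine ⟨min γ₁ 1, lt_min hγ₁ one_pos, κ, hκ, fun F γ hFL hγ hγle => ?_⟩
  obtain ⟨ψ, hψ0, hψt, H⟩ := H F γ hFL hγ (hγle.trans (min_le_left _ _))
  refine ⟨ψ, hψ0, hψt, fun ν hνK hνd J K hJK ρ hρpos hνρ hρc hgpos b b' U V W Z hU hV hW hZ hUV hUW hVZ hWZ => ?_⟩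
  rcases eq_or_lt_of_le hJK with hJKeq | hJKlt
  · subst hJKeq
    have hγ1 : γ ≤ 1 := hγle.trans (min_le_right _ _)
    have hc1 : c ≤ 1 := hcle.trans hc₀1
    have hν := (hνK J).symm.trans hνρ
    have h0 : ∀ {X : GaugeField (F.P J) 0 (Matrix.specialUnitaryGroup (Fin 2) ℂ)}, PlaqSmall (θBal F.L γ (c * b₀) p₀ J) X →
        Real.log (ρ X) - Real.log (heightDensityCan F γ hJK (histGood F ℰp (θBal F.L γ b₀ p₀) J J) X) =
          -Real.log (partitionFn (G := Matrix.specialUnitaryGroup (Fin 2) ℂ) (F.P J) ((F.scheme ℰp γ).β J)) :=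
      fun hX => log_sub_log_heightDensityCan_self_eq F hγ hγ1 hb hc1 p₀ hJK hν hρc hX
    rw [h0 hU, h0 hV, h0 hW, h0 hZ]
    norm_num
    exact mul_nonneg (hψ0 J) (Real.exp_pos _).le
  · exact H ν hνK hνd J K hJKlt ρ hρpos hνρ hρc hgpos b b' U V W Z hU hV hW hZ hUV hUW hVZ hWZ

end Doors

end Summit.QuantumFields.YangMills.Theorems.FluctuationComparisonRegPrIntLS2BetaTableDiagonalCan

end
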